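import Literature.MathematicalPhysics.QuantumFieldTheory.Balaban1983to89.T4ShellCount

/-!
# `Balaban1983to89.T4BadClassBooking` — the BOOKING RULES of NE7b's output binder `T4WeightBudget.RelWeightBound`
under enlargement of the bad class: necessity (the wall, transported from the shell weight to the bad-class weight),
the algebra of the class, ALL-YOUNG (bounded-age) classes, and a two-sided toy
(cell `pub-balaban`, T4-DAG v19 §6 NE7b / §5 row T4-U5c.E, node U5c; answers GAPS G-ne7cp2-7 = exit (B1) of
`T4SiblingInsertion` v1.1 §0 / pv07 RULE R-η-4; kernel siblings `T4WeightBudget` (pv14: the binder), `T4ShellCount`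
(t4-ne7c-p2: the age ledger and ITS wall for the shell weight), `T4PersistentHistoryCount` / `T4HistoryPeeling` /
`T4MatchingClosure` (NE7b's certified summability mechanism on the OLD window); record `t4/T4-EST-NE7b-P1.md` v1.4 §0 (j))

HONEST FRAMING (cell `pub-balaban`, T4-DAG PAGE 1).  The cell's T4 target is rung (B)+1: existence AND uniqueness of the
`ε → 0` limit of Bałaban's unit-scale averaged loop expectations on a FIXED finite torus — strictly beyond ultraviolet
stability ([Balaban1989LargeFieldII] Thm 1 p. 355), NOT infinite volume, NOT a mass gap, NOT the Clay problem.  This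
module is KERNEL BOOKKEEPING about ONE binder of the uniqueness spine — NE7b's output shape
`T4WeightBudget.RelWeightBound l₀ T A B Bad W` (fields `bad_subset`, `nonneg`, `lt_one`, `summable`, `bad_left`,
`bad_right`) — and says, in [folklore] real analysis over abstract finite families, WHICH ENLARGEMENTS OF THE CLASS
`Bad K t` the binder can absorb.  Nothing of Bałaban's is asserted: every `def … : Prop` below (`Saturated`, `AgeCover`)
is a HYPOTHESIS SHAPE of the cell's bookkeeping, labelled NOT PRINTED; the couplings never enter this file; the
conditionals BetaPertH / (B) / (B^μ) / U5a of the cell's records are untouched and never hidden in a definition.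
Value = a located BOOKING RULE for a cell design decision + kernel bookkeeping; NOT an estimate, NOT summit progress.

THE QUESTION (cell-internal; GAPS G-ne7cp2-7, `T4SiblingInsertion` v1.1 §0 (B1), pv07 RULE R-η-4).  Under design (η) of
node U5b the instantiating seat follows exit (B1) UN-MERGED INDEXATION: «keep every ℝ-reshaped branch (Z′ ≠ ∅ at some
window level) as a separate term of `Bad K t` with NO declared factors … their total weight is what NE7b's
`RelWeightBound` binds ON THE WINDOW ENLARGED BY PRINT'S RENORMALIZATION DELAY N» (module docstring of
`T4SiblingInsertion`, a CELL text, quoted as the thing answered — not a citation), the window being the bounded live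
window of ages `a ≤ N_w` plus print's delay `N`, both `K`-INDEPENDENT; «the quantitative booking is yours» (journal NOTE
of t4-ne7c-p2 to the NE7b owners).  THIS FILE'S ANSWER, in kernel terms:
* §1 NECESSITY.  A `RelWeightBound` dominates the relative bad weight at every admissible `t` by the SUMMABLE sequence
  `W`, so that relative weight is itself summable in `K` and tends to `0` (`summable_relWeight`,
  `tendsto_relWeight_zero`); a class SATURATED at a positive level — carrying at least a fixed fraction `c > 0` of a
  run's total weight at some admissible `t` along infinitely many cutoffs `K` (`Saturated`, hypothesis shape) — admits
  NO `RelWeightBound`, WHATEVER `W` (`not_relWeightBound_of_saturated`, `…_right`).  This is `T4ShellCount` §2's wall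
  (`not_summable_of_frequently_le`, `not_summable_ageWeight_of_ageOnly`) transported from the shell weight `Wsh` to the
  bad-class weight `W`: the binder's field `summable` is the same kind of demand.
* §2 ALGEBRA OF THE CLASS.  `RelWeightBound` is MONOTONE in `Bad` (`relWeightBound_mono`) and closed under UNION with
  added weights (`relWeightBound_union`, needs `W₁ + W₂ < 1`); contrapositive = THE BOOKING RULE: a class containing a
  saturated sub-class admits no binder (`not_relWeightBound_of_subset_saturated`).  So `Bad` may be enlarged by any
  class that has ITS OWN summable relative weight, and by nothing else.
* §3 ALL-YOUNG CLASSES.  A class covered, at every `(K, t)`, by sub-classes indexed by SLOTS `⟨a, i⟩` of ages `a ≤ N`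
  (`N` independent of `K`) with per-slot relative weights `x a K` (`AgeCover`, hypothesis shape — the shape exit (B1)
  produces: slot = level and cube of the first large-field region of the branch's ℝ′-event) has relative weight at most
  the AGE-LEDGER WEIGHT `T4ShellCount.ageWeight N n x K` (`AgeCover.bad_le`); hence (u) from AGE-ONLY data — cube counts
  `n a ≤ V Λ^a` and a per-age suppression `x a K ≤ e^{−p a}`, which is all the printed shapes give for a single run
  whose final coupling is renormalised (cell reading U5a: the per-region factor `exp(−p₀(g_j))` of (1.79) is indexed by
  the AGE `K − j`) — the certificate is the `K`-UNIFORM budget `V·Σ_{a ≤ N} Λ^a e^{−p a}` (`AgeCover.bad_le_uniform`),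
  `< ε` for EVERY `K` under an exponent floor `P` with `log V + log(N+1) + N·log Λ − P < log ε`
  (`uniformBudget_lt_of_rate`; with `Λ = L⁴` this is the node's printed-window condition «p₀(g)/N > 4 log L·(1 + o(1))»,
  `T4WeightBudget.survivalRate_pos_iff` currency; compatible with the assumption «N ≦ R_k» recorded on B16 p. 361 while
  bounding the third-order term of (1.20) — a cell reading: print's CONDITIONS on the window are B15 p. 198): it serves
  the every-`K`
  SMALLNESS `hlt` of `T4LipschitzLedger.cauchy_of_repr` / `T4IndicatorShell.cauchy_of_relWeightBound_shell` and the
  constants of exit (B2), NEVER the field `summable`; (s) WITH a LEVEL-anchored gain `x a K ≤ e^{−p a}·y(K − a)`,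
  `Σ y < ∞` (`T4ShellCount.LevelGain`, NOT PRINTED) the binder IS reached (`relWeightBound_of_ageCovers_levelGain`);
  (n) with ONE saturated slot it is out of reach (`AgeCover.not_relWeightBound_of_slot_saturated`).  NE7b's CERTIFIED
  summability mechanism is of kind (s) with the gain supplied by AGE ITSELF GROWING WITH `K` — the bad class of NE7b /
  NE7b-rem consists of terms with a pending component of age `≥ K − j⋆(K) → ∞` (two-rate majorant
  `T4HistoryPeeling.relWeightBound_of_slotDom_twoRate`, log window `T4MatchingClosure.relWeightBound_of_slotDom_twoRate_log`,
  credit `T4PersistentHistoryCount.credit_dominates_window`) — and is NOT AVAILABLE on a bounded age band.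
* §4 TOY, BOTH SIDES (non-vacuity of §1–§3 and the exact dividing line).  Histories = sets of levels `j ≤ K` carrying a
  toy large-field event, independent across levels with probabilities `q j`; the YOUNG class = «event at the final level
  `K`» (age `0`).  Its relative weight is EXACTLY `q K` (`Sanity.sum_Bad`, `Sanity.sum_T`): with an IR-anchored
  (constant) probability `q > 0` the class is saturated and NO `RelWeightBound` exists for ANY `W` and ANY second run
  (`Sanity.not_relWeightBound_const`); with a UV-anchored summable `q` (`q j < 1`, `Σ q < ∞`) the binder holds with
  `W = q` (`Sanity.relWeightBound_of_summable`).  Same class, same kernel shape; what decides is WHERE the smallness is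
  anchored.
CONSEQUENCE FOR THE CELL (booked in `t4/T4-EST-NE7b-P1.md` v1.4 §0 (j) and GAPS G-ne7bp1g5-1 as a located objection to a
CELL design rule — cell analysis, NO manuscript step affected, existence under (η) exactly as conditional as before):
exit (B1) is a legitimate use of NE7b's binder for ℝ-reshaped branches whose region CONTAINS a component of age
`≥ K − j⋆(K)` (NE7b / NE7b-rem class, already booked); for ALL-YOUNG ℝ-reshaped branches (every region of age `≤ N_w + N`)
no seat has a single-run quantity anchored at the level, the natural reading of the printed shapes saturates them
(§3 (u)/(n), §4), and their honest exits are (B2) of `T4SiblingInsertion` (the sibling ratio `r`, an NE7b-at-lowered-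
threshold ESTIMATE) or a TWO-RUN MATCHING of the ℝ-quotients (term-wise, or aggregated into one class per slot — node
U5b / NE3–NE5 species: the only UV-anchored quantity of the scheme is the two-run width `ρ_j` of (F∞), and it enters only
through matching).  Owners: pv07 (U5b ledger), t4-ne7c-p2 (`T4SiblingInsertion`).  This file decides nothing between
them; it certifies what the NE7b slot can and cannot be asked to carry.

CITATION HEADER (LOCATORS + the sentences THIS SEAT READ AS IMAGES on 2026-08-19 in the cell's page store
`b2b-balaban-ref1/pages/…` (PNG ×2); NOTHING below is used as a hypothesis of a theorem, the audited manuscripts are not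
cited for any disputed step — the sentences are CONTEXT for the hypothesis-shape names and for the reading «age-indexed»).
* [Balaban1989LargeFieldI] T. Bałaban, *Large field renormalization. I. The basic step of the ℝ operation*, Commun.
  Math. Phys. **122** (1989) 175–202 (cell paper B15; PDF page = journal page − 174).  p. 176 [render
  `1989-cmp122-large-field-I-p002-x2.png`]: «Z″ is a union of components of the region Z, for which the small factors
  connected with large field control some number of next steps, Z′ is a union of remaining components, i.e. components
  for which the corresponding expressions require a renormalization.», (0.3) `(ℝρ)(V) = Σ_Z ρ(Z″, V) ∫dV⌈_{Z′}ρ(Z, V) /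
  ∫dV⌈_{Z′}ρ(Z″, V)`, «The quotients are still small, because some small factors in the regions Z′ are left for the
  densities in the numerator.» and «the densities on the right-hand side still have enough small factors to control the
  given number of steps» — SIZE statements about ONE run; p. 177 [render `…-p003-x2.png`], the renormalised class:
  «(i) it is contained in a cube of the size 100MR_k, (ii) in the preceding N renormalization steps no new large field
  regions were created inside this component, and the previous regions contained in it satisfy the condition (i) on the
  corresponding scales.»; p. 198 [render `…-p024-x2.png`], the window: «The last inequality holds under two restrictions
  on N. At first, we assume that N ≤ O(1)(log g_k^{−2})^ν ≤ O(1)(1 + β₀)(log g_h^{−2})^ν with a positive integer ν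
  satisfying (1/2)ν ≤ p₀ − p₁ − 1. The second is that N has to be sufficiently large, so that the constant in the second
  term above can be bounded by (1/2)α. These two conditions can be satisfied by N to the positive power of log g_k^{−2}.»
  — the delay `N = N(g_k)` is a function of the coupling at the CURRENT step: at the final steps of a run with
  renormalised final coupling it is `K`-INDEPENDENT (cell conditional U5a), which is why the (B1) class is ALL-YOUNG.
* [Balaban1989LargeFieldII] T. Bałaban, *Large field renormalization. II. Localization, exponentiation, and bounds for
  the ℝ operation*, Commun. Math. Phys. **122** (1989) 355–392 (cell paper B16; PDF page = journal page − 354).  p. 361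
  [render `1989-cmp122-large-field-II-p007-x2.png`]: «We have assumed here that N ≤ R_k.» — an assumption recorded on
  B16 p. 361 WHILE BOUNDING THE THIRD-ORDER TERM of the effective action (1.20) (it feeds the count `|𝐁₀| ≤ (100MR_k)^d N²`
  there); it is NOT print's statement of the window conditions, which are B15 p. 198 above (GAPS-T4 G-t4r2-17 / G-t4r2-5).
  Cell reading only: that assumption is COMPATIBLE with the B15 p. 198 window, and under `N ≤ R_k` with `R_k` a power of
  `log g_k^{−2}` below `p₀`'s the survival condition of §3 holds (tree `B14.IsRj`, this lineage's
  `T4PersistentHistoryCount.credit_dominates_window`); p. 383 [render `…-p029-x2.png`],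
  (1.79) `𝐓′_k(X)1 ≤ sup exp{Σ_{j=1}^{k} O(1)M^dR_j^{d+1}d′_j(Z_j)} · ∏_{j=1}^{k}∏_i exp(−½γ₀A₁²p₀²(g_j)(d′_j(Z_j^{(i)}) + 1)
  − 2p₀(g_j)) ∏′ exp(−p₀(g_j))`, «where the last product is over components of Z_j satisfying the conditions (i), (ii),
  for which some large fields are created during the preparatory steps.» and «Finally, the summations over the
  admissible sequences can be replaced by the factors exp O(1)(MR_j)^{−d}|Z_j|.» — the printed per-region SUPPRESSION
  and ENTROPY are indexed by the creation step `j`, i.e. by the AGE `K − j` once the final coupling is renormalised: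
  AGE-ONLY data in the sense of §3 (u).  These are UPPER bounds for one run at one cutoff; NO lower bound on any
  large-field weight of Bałaban's is printed or asserted here — saturation (§1) is a HYPOTHESIS SHAPE, and the cell's
  reason to expect it for all-young classes (no `K`-dependent single-run input exists; `T4ShellCount` §2,
  `T4BookingNecessity` §4 concur for the shell / remnant analogues) is a READING recorded in `t4/T4-EST-NE7b-P1.md` §0 (j).

WHAT IS PROVED (kernel; all [folklore]; zero `sorry`, no new axiom; imports `T4ShellCount` only, hence
`T4WeightBudget` / `T4IndicatorShell` / `T4NestedShells` transitively; modifies nothing).  §1 `relWeightBound_tendsto_zero`,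
`le_weight_of_fraction_le(_right)`, `summable_relWeight`, `tendsto_relWeight_zero`, `Saturated`,
`saturated_of_frequently_le`, `not_relWeightBound_of_saturated(_right)`, `not_exists_relWeightBound_of_saturated`;
§2 `relWeightBound_mono`, `relWeightBound_union`, `not_relWeightBound_of_subset_saturated`; §3 `slots`, `AgeCover`,
`sum_slots_eq_ageWeight`, `AgeCover.bad_le`, `AgeCover.bad_le_uniform`, `printedBudget_le_of_floor`,
`uniformBudget_lt_of_rate`, `AgeCover.bad_lt_of_rate`, `relWeightBound_of_ageCovers`,
`relWeightBound_of_ageCovers_levelGain`, `AgeCover.not_relWeightBound_of_slot_saturated`; §4 `Sanity.*` (the product toy: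
`sum_T`, `sum_Bad`, `saturated_const`, `not_relWeightBound_const`, `relWeightBound_of_summable`).
Unit `b2b-balaban-t4-ne7b-p1` gen 5 (journal CLAIM T4-U5c.E-NE7b-BADWINDOW-K* 2026-08-19T11:38:47Z). [folklore arithmetic]
v1.0.1 (gen 6, DOCFIX GAPS-T4 G-t4r2-17, referee ref2 pass 11): three docstring phrases that called B16 p. 361 «N ≦ R_k»
«print's cap on the window» / «print's window» re-worded — that sentence is an assumption made while bounding the
third-order term of (1.20); print's window conditions are B15 p. 198.  No declaration, statement or proof changed.
-/

noncomputable section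

open Finset _root_.Filter _root_.Topology

namespace Literature.MathematicalPhysics.QuantumFieldTheory.Balaban1983to89.T4BadClassBooking

open T4WeightBudget T4ShellCount

/-! ## §1 Necessity: what a `RelWeightBound` forces on its class, and the wall -/

section Necessity

variable {ι : Type*} {l₀ : ℝ} {T : ℕ → Finset ι} {A B : ℕ → ℝ → ι → ℝ} {Bad : ℕ → ℝ → Finset ι} {W : ℕ → ℝ}

/-- A `RelWeightBound` forces its weight sequence to tend to `0`. [folklore] -/
theorem relWeightBound_tendsto_zero (hW : RelWeightBound l₀ T A B Bad W) : Tendsto W atTop (𝓝 0) :=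
  hW.summable.tendsto_atTop_zero

/-- … hence the weight is eventually below any `ε > 0`. [folklore] -/
theorem relWeightBound_eventually_lt (hW : RelWeightBound l₀ T A B Bad W) {ε : ℝ} (hε : 0 < ε) :
    ∀ᶠ K in atTop, W K < ε :=
  (relWeightBound_tendsto_zero hW).eventually (gt_mem_nhds hε)

/-- FRACTION EXTRACTION, run A: if at an admissible `(K, t)` with positive total weight the class carries at least the
fraction `c` of the total, then `c ≤ W K`. [folklore] -/
theorem le_weight_of_fraction_le (hW : RelWeightBound l₀ T A B Bad W) {K : ℕ} {t c : ℝ}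
    (ht : |t| ≤ l₀) (hpos : 0 < ∑ τ ∈ T K, A K t τ)
    (hc : c * ∑ τ ∈ T K, A K t τ ≤ ∑ τ ∈ Bad K t, A K t τ) : c ≤ W K :=
  le_of_mul_le_mul_right (hc.trans (hW.bad_left K t ht)) hpos

/-- FRACTION EXTRACTION, run B. [folklore] -/
theorem le_weight_of_fraction_le_right (hW : RelWeightBound l₀ T A B Bad W) {K : ℕ} {t c : ℝ}
    (ht : |t| ≤ l₀) (hpos : 0 < ∑ τ ∈ T K, B K t τ)
    (hc : c * ∑ τ ∈ T K, B K t τ ≤ ∑ τ ∈ Bad K t, B K t τ) : c ≤ W K :=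
  le_of_mul_le_mul_right (hc.trans (hW.bad_right K t ht)) hpos

/-- NECESSITY, POSITIVE FORM: under a `RelWeightBound` the RELATIVE bad weight at any fixed admissible `t` (nonnegative
terms, positive totals) is dominated by `W`, hence SUMMABLE in `K` … [folklore] -/
theorem summable_relWeight (hW : RelWeightBound l₀ T A B Bad W) {t : ℝ} (ht : |t| ≤ l₀)
    (hA : ∀ K, ∀ τ ∈ T K, 0 ≤ A K t τ) (hpos : ∀ K, 0 < ∑ τ ∈ T K, A K t τ) :
    Summable (fun K => (∑ τ ∈ Bad K t, A K t τ) / ∑ τ ∈ T K, A K t τ) := by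
  refine hW.summable.of_nonneg_of_le (fun K => ?_) (fun K => ?_)
  · exact div_nonneg (sum_nonneg fun τ hτ => hA K τ (hW.bad_subset K t ht hτ)) (hpos K).le
  · rw [div_le_iff₀ (hpos K)]
    exact hW.bad_left K t ht

/-- … and in particular it TENDS TO `0`: no class whose relative weight stays away from `0` can sit inside `Bad`.
[folklore] -/
theorem tendsto_relWeight_zero (hW : RelWeightBound l₀ T A B Bad W) {t : ℝ} (ht : |t| ≤ l₀)
    (hA : ∀ K, ∀ τ ∈ T K, 0 ≤ A K t τ) (hpos : ∀ K, 0 < ∑ τ ∈ T K, A K t τ) :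
    Tendsto (fun K => (∑ τ ∈ Bad K t, A K t τ) / ∑ τ ∈ T K, A K t τ) atTop (𝓝 0) :=
  (summable_relWeight hW ht hA hpos).tendsto_atTop_zero

/-- NAMED HYPOTHESIS SHAPE `Saturated` (cell bookkeeping; NOT PRINTED, NOT asserted for Bałaban's terms): in the run with
term weights `X`, the class `Bad` is SATURATED AT LEVEL `c` — along infinitely many cutoffs `K` there is an admissible
source strength `|t| ≤ l₀` at which the total weight is positive and the class carries at least the fraction `c` of it.
(The cell's reading of an ALL-YOUNG ℝ-class under U5a: its printed per-age data are `K`-independent, so nothing makes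
the fraction fall with `K`; §3 (n), §4.) [folklore] -/
def Saturated (l₀ : ℝ) (T : ℕ → Finset ι) (X : ℕ → ℝ → ι → ℝ) (Bad : ℕ → ℝ → Finset ι) (c : ℝ) : Prop :=
  ∃ᶠ K in atTop, ∃ t : ℝ, |t| ≤ l₀ ∧ 0 < ∑ τ ∈ T K, X K t τ ∧ c * ∑ τ ∈ T K, X K t τ ≤ ∑ τ ∈ Bad K t, X K t τ

/-- Saturation from ONE admissible source strength at which the fraction is `≥ c` along infinitely many `K`. [folklore] -/
theorem saturated_of_frequently_le {X : ℕ → ℝ → ι → ℝ} {c t : ℝ} (ht : |t| ≤ l₀)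
    (hpos : ∀ K, 0 < ∑ τ ∈ T K, X K t τ)
    (h : ∃ᶠ K in atTop, c * ∑ τ ∈ T K, X K t τ ≤ ∑ τ ∈ Bad K t, X K t τ) : Saturated l₀ T X Bad c :=
  h.mono fun K hK => ⟨t, ht, hpos K, hK⟩

/-- **THE WALL FOR THE BAD-CLASS BINDER, run A.**  A class saturated at a positive level in run A admits NO
`RelWeightBound` — for NO weight sequence `W` and whatever the second run: `c ≤ W K` infinitely often contradicts
`Summable W` (`T4ShellCount.not_summable_of_frequently_le`). [folklore] -/
theorem not_relWeightBound_of_saturated {c : ℝ} (hc : 0 < c) (hsat : Saturated l₀ T A Bad c) (W : ℕ → ℝ) :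
    ¬ RelWeightBound l₀ T A B Bad W := by
  intro hW
  refine not_summable_of_frequently_le hc (hsat.mono fun K hK => ?_) hW.summable
  obtain ⟨t, ht, hpos, hle⟩ := hK
  exact le_weight_of_fraction_le hW ht hpos hle

/-- **THE WALL, run B.** [folklore] -/
theorem not_relWeightBound_of_saturated_right {c : ℝ} (hc : 0 < c) (hsat : Saturated l₀ T B Bad c) (W : ℕ → ℝ) :
    ¬ RelWeightBound l₀ T A B Bad W := by
  intro hW
  refine not_summable_of_frequently_le hc (hsat.mono fun K hK => ?_) hW.summable
  obtain ⟨t, ht, hpos, hle⟩ := hK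
  exact le_weight_of_fraction_le_right hW ht hpos hle

/-- No weight sequence at all books a saturated class. [folklore] -/
theorem not_exists_relWeightBound_of_saturated {c : ℝ} (hc : 0 < c) (hsat : Saturated l₀ T A Bad c) :
    ¬ ∃ W : ℕ → ℝ, RelWeightBound l₀ T A B Bad W :=
  fun ⟨W, hW⟩ => not_relWeightBound_of_saturated hc hsat W hW

end Necessity

/-! ## §2 The algebra of the class: monotonicity, union, and the booking rule -/

section Algebra

variable {ι : Type*} {l₀ : ℝ} {T : ℕ → Finset ι} {A B : ℕ → ℝ → ι → ℝ} {Bad Bad' : ℕ → ℝ → Finset ι} {W : ℕ → ℝ}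

/-- **MONOTONICITY IN THE CLASS.**  A `RelWeightBound` for `Bad` is one for every sub-class `Bad' ⊆ Bad` (nonnegative
terms), with the same weights. [folklore] -/
theorem relWeightBound_mono (hW : RelWeightBound l₀ T A B Bad W) (hsub : ∀ K t, |t| ≤ l₀ → Bad' K t ⊆ Bad K t)
    (hA : ∀ K t, |t| ≤ l₀ → ∀ τ ∈ T K, 0 ≤ A K t τ) (hB : ∀ K t, |t| ≤ l₀ → ∀ τ ∈ T K, 0 ≤ B K t τ) :
    RelWeightBound l₀ T A B Bad' W where
  bad_subset K t ht := (hsub K t ht).trans (hW.bad_subset K t ht)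
  nonneg := hW.nonneg
  lt_one := hW.lt_one
  summable := hW.summable
  bad_left K t ht :=
    (sum_le_sum_of_subset_of_nonneg (hsub K t ht) fun τ hτ _ => hA K t ht τ (hW.bad_subset K t ht hτ)).trans
      (hW.bad_left K t ht)
  bad_right K t ht :=
    (sum_le_sum_of_subset_of_nonneg (hsub K t ht) fun τ hτ _ => hB K t ht τ (hW.bad_subset K t ht hτ)).trans
      (hW.bad_right K t ht)

/-- **THE BOOKING RULE (contrapositive of monotonicity).**  A class CONTAINING a sub-class saturated at a positive level
(in run A) admits no `RelWeightBound`, whatever `W`: `Bad` may be enlarged only by classes that come with their own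
summable relative weight. [folklore] -/
theorem not_relWeightBound_of_subset_saturated (hsub : ∀ K t, |t| ≤ l₀ → Bad' K t ⊆ Bad K t)
    (hA : ∀ K t, |t| ≤ l₀ → ∀ τ ∈ T K, 0 ≤ A K t τ) (hB : ∀ K t, |t| ≤ l₀ → ∀ τ ∈ T K, 0 ≤ B K t τ)
    {c : ℝ} (hc : 0 < c) (hsat : Saturated l₀ T A Bad' c) (W : ℕ → ℝ) : ¬ RelWeightBound l₀ T A B Bad W :=
  fun hW => not_relWeightBound_of_saturated hc hsat W (relWeightBound_mono hW hsub hA hB)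

/-- **UNION.**  Two classes with `RelWeightBound`s of weights `W₁`, `W₂` and `W₁ K + W₂ K < 1` give one for the union
with weights `W₁ + W₂` (nonnegative terms). [folklore] -/
theorem relWeightBound_union [DecidableEq ι] {Bad₁ Bad₂ : ℕ → ℝ → Finset ι} {W₁ W₂ : ℕ → ℝ}
    (h₁ : RelWeightBound l₀ T A B Bad₁ W₁) (h₂ : RelWeightBound l₀ T A B Bad₂ W₂) (hlt : ∀ K, W₁ K + W₂ K < 1)
    (hA : ∀ K t, |t| ≤ l₀ → ∀ τ ∈ T K, 0 ≤ A K t τ) (hB : ∀ K t, |t| ≤ l₀ → ∀ τ ∈ T K, 0 ≤ B K t τ) :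
    RelWeightBound l₀ T A B (fun K t => Bad₁ K t ∪ Bad₂ K t) (W₁ + W₂) where
  bad_subset K t ht := union_subset (h₁.bad_subset K t ht) (h₂.bad_subset K t ht)
  nonneg K := add_nonneg (h₁.nonneg K) (h₂.nonneg K)
  lt_one K := by rw [Pi.add_apply]; exact hlt K
  summable := h₁.summable.add h₂.summable
  bad_left K t ht := by
    have hui := sum_union_inter (s₁ := Bad₁ K t) (s₂ := Bad₂ K t) (f := A K t)
    have hint : 0 ≤ ∑ τ ∈ Bad₁ K t ∩ Bad₂ K t, A K t τ :=
      sum_nonneg fun τ hτ => hA K t ht τ (h₁.bad_subset K t ht (mem_inter.1 hτ).1)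
    have hl₁ := h₁.bad_left K t ht
    have hl₂ := h₂.bad_left K t ht
    rw [Pi.add_apply, add_mul]
    linarith
  bad_right K t ht := by
    have hui := sum_union_inter (s₁ := Bad₁ K t) (s₂ := Bad₂ K t) (f := B K t)
    have hint : 0 ≤ ∑ τ ∈ Bad₁ K t ∩ Bad₂ K t, B K t τ :=
      sum_nonneg fun τ hτ => hB K t ht τ (h₁.bad_subset K t ht (mem_inter.1 hτ).1)
    have hr₁ := h₁.bad_right K t ht
    have hr₂ := h₂.bad_right K t ht
    rw [Pi.add_apply, add_mul]
    linarith

end Algebra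

/-! ## §3 ALL-YOUNG classes: age covers, the uniform budget, the survival condition, and the two outcomes -/

section AgeCover

variable {ι : Type*} [DecidableEq ι] {l₀ : ℝ} {T : ℕ → Finset ι} {X A B : ℕ → ℝ → ι → ℝ} {Bad : ℕ → ℝ → Finset ι}
  {N : ℕ} {n : ℕ → ℕ} {x : ℕ → ℕ → ℝ}

/-- The SLOT index set of a bounded age band: ages `a ≤ N`, copies `i < n a` (as in `T4LipschitzCutoff.LipSlotLedger`,
`T4ShellCount.AgeLedger`). (bookkeeping) [folklore] -/
def slots (N : ℕ) (n : ℕ → ℕ) : Finset (Σ _ : ℕ, ℕ) := (range (N + 1)).sigma fun a => range (n a)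

/-- NAMED HYPOTHESIS SHAPE `AgeCover` (cell bookkeeping, NOT PRINTED, NOT asserted): in the run with term weights `X`, at
every cutoff `K` and `|t| ≤ l₀`, the class `Bad K t` is COVERED by sub-classes `Slot K σ t ⊆ T K` indexed by the slots
`σ = ⟨a, i⟩` of a `K`-INDEPENDENT age band `a ≤ N` — an ALL-YOUNG class —, each of relative weight at most `x a K ≥ 0`.
READING under exit (B1): `Slot K ⟨a, i⟩ t` = the ℝ-reshaped branches whose ℝ′-event has its first large-field region
created at level `K − a` in the `i`-th cube of that level, `N = N_w + N` (live window + print's delay), `x a K` = the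
per-slot relative weight bound the instantiating seat can certify. [folklore] -/
structure AgeCover (l₀ : ℝ) (T : ℕ → Finset ι) (X : ℕ → ℝ → ι → ℝ) (Bad : ℕ → ℝ → Finset ι) (N : ℕ) (n : ℕ → ℕ)
    (Slot : ℕ → (Σ _ : ℕ, ℕ) → ℝ → Finset ι) (x : ℕ → ℕ → ℝ) : Prop where
  /-- slots are classes of terms -/
  slot_subset : ∀ K t, |t| ≤ l₀ → ∀ σ ∈ slots N n, Slot K σ t ⊆ T K
  /-- the slots cover the class -/
  cover : ∀ K t, |t| ≤ l₀ → Bad K t ⊆ (slots N n).biUnion fun σ => Slot K σ t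
  /-- per-slot relative weight bound, depending on the slot's AGE and on `K` -/
  slot_le : ∀ K t, |t| ≤ l₀ → ∀ σ ∈ slots N n, ∑ τ ∈ Slot K σ t, X K t τ ≤ x σ.1 K * ∑ τ ∈ T K, X K t τ
  /-- the bounds are nonnegative -/
  x_nonneg : ∀ a ≤ N, ∀ K, 0 ≤ x a K

omit [DecidableEq ι] in
/-- Summing a per-age quantity over the slots gives the AGE-LEDGER WEIGHT of `T4ShellCount`:
`Σ_{⟨a,i⟩ ∈ slots} x a K = Σ_{a ≤ N} n a · x a K = ageWeight N n x K`. [folklore] -/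
theorem sum_slots_eq_ageWeight (N : ℕ) (n : ℕ → ℕ) (x : ℕ → ℕ → ℝ) (K : ℕ) :
    ∑ σ ∈ slots N n, x σ.1 K = ageWeight N (fun a => (n a : ℝ)) x K := by
  unfold slots ageWeight
  rw [sum_sigma]
  refine sum_congr rfl fun a _ => ?_
  dsimp only
  rw [sum_const, card_range, nsmul_eq_mul]

/-- **AN AGE COVER BOUNDS THE CLASS BY THE AGE-LEDGER WEIGHT**: `Σ_{Bad} X ≤ ageWeight N n x K · Σ_{T} X` at every
admissible `(K, t)` (nonnegative terms; the union bound `T4WeightBudget.relWeight_le_sum_of_cover`). [folklore] -/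
theorem AgeCover.bad_le {Slot : ℕ → (Σ _ : ℕ, ℕ) → ℝ → Finset ι} (h : AgeCover l₀ T X Bad N n Slot x)
    (hX : ∀ K t, |t| ≤ l₀ → ∀ τ ∈ T K, 0 ≤ X K t τ) {K : ℕ} {t : ℝ} (ht : |t| ≤ l₀) :
    ∑ τ ∈ Bad K t, X K t τ ≤ ageWeight N (fun a => (n a : ℝ)) x K * ∑ τ ∈ T K, X K t τ := by
  -- truncate the family outside `T K` so that it is globally nonnegative
  set f : ι → ℝ := fun τ => if τ ∈ T K then X K t τ else 0 with hf
  have hf0 : ∀ τ, 0 ≤ f τ := fun τ => by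
    simp only [hf]
    split_ifs with hτ
    · exact hX K t ht τ hτ
    · exact le_rfl
  have hfeq : ∀ s : Finset ι, s ⊆ T K → ∑ τ ∈ s, f τ = ∑ τ ∈ s, X K t τ := fun s hs =>
    sum_congr rfl fun τ hτ => by simp only [hf, if_pos (hs hτ)]
  have hBadT : Bad K t ⊆ T K := (h.cover K t ht).trans (biUnion_subset.2 fun σ hσ => h.slot_subset K t ht σ hσ)
  have hcov := relWeight_le_sum_of_cover (slots N n) (fun σ => Slot K σ t) (Bad := Bad K t) (T := T K) (a := f)
    (w := fun σ => x σ.1 K) hf0 (h.cover K t ht) (fun σ hσ => by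
      rw [hfeq _ (h.slot_subset K t ht σ hσ), hfeq _ Subset.rfl]
      exact h.slot_le K t ht σ hσ)
  rw [hfeq _ hBadT, hfeq _ Subset.rfl, sum_slots_eq_ageWeight] at hcov
  exact hcov

/-- **(u) AGE-ONLY DATA ⇒ THE `K`-UNIFORM BUDGET.**  With cube counts `n a ≤ V·Λ^a` (`T4ShellCount.CubeCount`, PRINTED
SHAPE) and a per-age suppression `0 ≤ x a K ≤ e^{−p a}` (`T4ShellCount.LoweredThresholdSuppression`, NE7b species, NOT
PRINTED as a ratio statement) the class has relative weight `≤ V·Σ_{a ≤ N} Λ^a e^{−p a}` for EVERY `K`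
(`T4ShellCount.ageWeight_le_of_printedShapes` by name) — a number, not a summable sequence. [folklore] -/
theorem AgeCover.bad_le_uniform {Slot : ℕ → (Σ _ : ℕ, ℕ) → ℝ → Finset ι} {V Λ : ℝ} {p : ℕ → ℝ}
    (h : AgeCover l₀ T X Bad N n Slot x) (hX : ∀ K t, |t| ≤ l₀ → ∀ τ ∈ T K, 0 ≤ X K t τ)
    (hc : CubeCount N n V Λ) (hsup : LoweredThresholdSuppression N x p) {K : ℕ} {t : ℝ} (ht : |t| ≤ l₀) :
    ∑ τ ∈ Bad K t, X K t τ ≤ (V * ∑ a ∈ range (N + 1), Λ ^ a * Real.exp (-p a)) * ∑ τ ∈ T K, X K t τ :=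
  (h.bad_le hX ht).trans
    (mul_le_mul_of_nonneg_right (ageWeight_le_of_printedShapes hc hsup K) (sum_nonneg (hX K t ht)))

omit [DecidableEq ι] in
/-- The printed-shape budget under a UNIFORM EXPONENT FLOOR `P` on the band (`p a ≥ P` for `a ≤ N`: all couplings of the
band small) and `Λ ≥ 1`: `V·Σ_{a ≤ N} Λ^a e^{−p a} ≤ V·(N + 1)·Λ^N·e^{−P}`. [folklore] -/
theorem printedBudget_le_of_floor {V Λ P : ℝ} {p : ℕ → ℝ} {N : ℕ} (hV : 0 ≤ V) (hΛ : 1 ≤ Λ)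
    (hp : ∀ a ≤ N, P ≤ p a) :
    V * ∑ a ∈ range (N + 1), Λ ^ a * Real.exp (-p a) ≤ V * ((N + 1) * (Λ ^ N * Real.exp (-P))) := by
  refine mul_le_mul_of_nonneg_left ?_ hV
  have hterm : ∀ a ∈ range (N + 1), Λ ^ a * Real.exp (-p a) ≤ Λ ^ N * Real.exp (-P) := fun a ha => by
    have ha' := Finset.mem_range_succ_iff.1 ha
    exact mul_le_mul (pow_le_pow_right₀ hΛ ha') (Real.exp_le_exp.2 (neg_le_neg (hp a ha')))
      (Real.exp_pos _).le (pow_nonneg (zero_le_one.trans hΛ) _)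
  calc ∑ a ∈ range (N + 1), Λ ^ a * Real.exp (-p a) ≤ ∑ _a ∈ range (N + 1), Λ ^ N * Real.exp (-P) :=
        sum_le_sum hterm
    _ = (N + 1) * (Λ ^ N * Real.exp (-P)) := by rw [sum_const, card_range, nsmul_eq_mul]; push_cast; ring

omit [DecidableEq ι] in
/-- **THE SURVIVAL CONDITION SERVES THE UNIFORM SMALLNESS** (and only that): `V·(N+1)·Λ^N·e^{−P} < ε` as soon as
`log V + log(N + 1) + N·log Λ − P < log ε`.  With `Λ = L⁴` this reads `P/N > 4·log L + (log V + log(N+1) + log ε⁻¹)/N`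
— the node's printed-window condition «p₀(g)/N > 4 log L·(1 + o(1))» in the currency of
`T4WeightBudget.survivalRate_pos_iff`; it holds under the assumption «N ≦ R_k» that [Balaban1989LargeFieldII] p. 361
records while bounding the third-order term of (1.20) (a cell reading, compatible with the B15 p. 198 window conditions —
not print's statement of them), because `R_k` is a power of `log g_k^{−2}` below `p₀`'s (tree `B14.IsRj`; this lineage's
`T4PersistentHistoryCount.credit_dominates_window`).  It buys `W_K + Wsh_K < 1` for every `K` (the binder `hlt`), NOT
`Summable W`. [folklore] -/
theorem uniformBudget_lt_of_rate {V Λ P ε : ℝ} {N : ℕ} (hV : 0 < V) (hΛ : 1 ≤ Λ) (hε : 0 < ε)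
    (h : Real.log V + Real.log (N + 1) + N * Real.log Λ - P < Real.log ε) :
    V * ((N + 1) * (Λ ^ N * Real.exp (-P))) < ε := by
  have hΛ0 : 0 < Λ := zero_lt_one.trans_le hΛ
  have hN : (0 : ℝ) < N + 1 := by positivity
  have key : V * ((N + 1) * (Λ ^ N * Real.exp (-P))) =
      Real.exp (Real.log V + Real.log (N + 1) + N * Real.log Λ - P) := by
    rw [sub_eq_add_neg, Real.exp_add, Real.exp_add, Real.exp_add, Real.exp_log hV, Real.exp_log hN,
      ← Real.log_pow, Real.exp_log (pow_pos hΛ0 N)]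
    ring
  rw [key, ← Real.exp_log hε]
  exact Real.exp_lt_exp.2 h

/-- **(u′) EVERY-`K` SMALLNESS OF AN ALL-YOUNG CLASS FROM THE SURVIVAL CONDITION**: age cover + cube count + per-age
suppression with exponent floor `P` + the rate inequality ⇒ `Σ_{Bad} X < ε·Σ_{T} X` (or `≤` when the total vanishes)
at every admissible `(K, t)`.  This is what NE7b's COUNT gives an all-young class: a bound UNIFORM in `K`. [folklore] -/
theorem AgeCover.bad_le_of_rate {Slot : ℕ → (Σ _ : ℕ, ℕ) → ℝ → Finset ι} {V Λ P ε : ℝ} {p : ℕ → ℝ}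
    (h : AgeCover l₀ T X Bad N n Slot x) (hX : ∀ K t, |t| ≤ l₀ → ∀ τ ∈ T K, 0 ≤ X K t τ)
    (hc : CubeCount N n V Λ) (hsup : LoweredThresholdSuppression N x p) (hV : 0 < V) (hΛ : 1 ≤ Λ) (hε : 0 < ε)
    (hp : ∀ a ≤ N, P ≤ p a) (hrate : Real.log V + Real.log (N + 1) + N * Real.log Λ - P < Real.log ε)
    {K : ℕ} {t : ℝ} (ht : |t| ≤ l₀) :
    ∑ τ ∈ Bad K t, X K t τ ≤ ε * ∑ τ ∈ T K, X K t τ :=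
  (h.bad_le_uniform hX hc hsup ht).trans (mul_le_mul_of_nonneg_right
    ((printedBudget_le_of_floor hV.le hΛ hp).trans (uniformBudget_lt_of_rate hV hΛ hε hrate).le)
    (sum_nonneg (hX K t ht)))

/-- **CONSTRUCTOR: TWO AGE COVERS WITH A SMALL AND SUMMABLE AGE-LEDGER WEIGHT GIVE THE BINDER.**  Age covers of the
same class in both runs (same band, counts and per-slot bounds — take the larger of two bounds), nonnegative terms,
`ageWeight N n x K < 1` for every `K` and `Summable (ageWeight N n x)` ⇒ `RelWeightBound` with `W = ageWeight N n x`.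
The summability is an INPUT here; §3 (s)/(n) say when it is available. [folklore] -/
theorem relWeightBound_of_ageCovers {SlotA SlotB : ℕ → (Σ _ : ℕ, ℕ) → ℝ → Finset ι}
    (hA : AgeCover l₀ T A Bad N n SlotA x) (hB : AgeCover l₀ T B Bad N n SlotB x)
    (hA0 : ∀ K t, |t| ≤ l₀ → ∀ τ ∈ T K, 0 ≤ A K t τ) (hB0 : ∀ K t, |t| ≤ l₀ → ∀ τ ∈ T K, 0 ≤ B K t τ)
    (hlt : ∀ K, ageWeight N (fun a => (n a : ℝ)) x K < 1) (hs : Summable (ageWeight N (fun a => (n a : ℝ)) x)) :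
    RelWeightBound l₀ T A B Bad (ageWeight N (fun a => (n a : ℝ)) x) where
  bad_subset K t ht := (hA.cover K t ht).trans (biUnion_subset.2 fun σ hσ => hA.slot_subset K t ht σ hσ)
  nonneg K := sum_nonneg fun a ha => mul_nonneg (Nat.cast_nonneg _) (hA.x_nonneg a (Finset.mem_range_succ_iff.1 ha) K)
  lt_one := hlt
  summable := hs
  bad_left _ _ ht := hA.bad_le hA0 ht
  bad_right _ _ ht := hB.bad_le hB0 ht

/-- **(s) WITH A LEVEL-ANCHORED GAIN THE BINDER IS REACHED.**  If the per-slot bounds factorise as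
`x a K ≤ e^{−p a}·y(K − a)` with `y ≥ 0` summable over LEVELS (`T4ShellCount.LevelGain`, NOT PRINTED — the only
level-anchored quantity of the scheme is the two-run width `ρ_j` of (F∞), reachable only through MATCHING), the
age-ledger weight is summable (`T4ShellCount.summable_of_levelGain`) and two age covers with `ageWeight < 1` give the
binder. [folklore] -/
theorem relWeightBound_of_ageCovers_levelGain {SlotA SlotB : ℕ → (Σ _ : ℕ, ℕ) → ℝ → Finset ι} {p y : ℕ → ℝ}
    (hA : AgeCover l₀ T A Bad N n SlotA x) (hB : AgeCover l₀ T B Bad N n SlotB x)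
    (hA0 : ∀ K t, |t| ≤ l₀ → ∀ τ ∈ T K, 0 ≤ A K t τ) (hB0 : ∀ K t, |t| ≤ l₀ → ∀ τ ∈ T K, 0 ≤ B K t τ)
    (hg : LevelGain N x p y) (hlt : ∀ K, ageWeight N (fun a => (n a : ℝ)) x K < 1) :
    RelWeightBound l₀ T A B Bad (ageWeight N (fun a => (n a : ℝ)) x) :=
  relWeightBound_of_ageCovers hA hB hA0 hB0 hlt (summable_of_levelGain hg)

/-- **(n) WITH ONE SATURATED SLOT THE BINDER IS OUT OF REACH.**  If one slot's sub-class lies inside `Bad` and is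
saturated at a positive level in run A (e.g. the final-level slot: present in every cutoff, its printed suppression a
fixed number), then `Bad` admits no `RelWeightBound`, whatever `W` — however small the UNIFORM budget of (u) is.
[folklore] -/
theorem AgeCover.not_relWeightBound_of_slot_saturated {Slot : ℕ → (Σ _ : ℕ, ℕ) → ℝ → Finset ι}
    (_h : AgeCover l₀ T A Bad N n Slot x) {σ : Σ _ : ℕ, ℕ} (hin : ∀ K t, |t| ≤ l₀ → Slot K σ t ⊆ Bad K t)
    (hA0 : ∀ K t, |t| ≤ l₀ → ∀ τ ∈ T K, 0 ≤ A K t τ) (hB0 : ∀ K t, |t| ≤ l₀ → ∀ τ ∈ T K, 0 ≤ B K t τ)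
    {s₀ : ℝ} (hs₀ : 0 < s₀) (hsat : Saturated l₀ T A (fun K t => Slot K σ t) s₀) (W : ℕ → ℝ) :
    ¬ RelWeightBound l₀ T A B Bad W :=
  not_relWeightBound_of_subset_saturated hin hA0 hB0 hs₀ hsat W

end AgeCover

/-! ## §4 Sanity: the product toy — ONE young class, saturated under IR-anchored smallness, booked under UV-anchored
smallness (non-vacuity of §1–§3; NOT Bałaban's terms, no print involved)

Histories `τ ⊆ {0, …, K}` = the set of levels carrying a toy large-field event, with INDEPENDENT per-level probabilities
`q j ∈ [0, 1]`: term weight `A q K t τ = ∏_{j ∈ τ} q j · ∏_{j ≤ K, j ∉ τ} (1 − q j)` (no `t`-dependence).  The YOUNG class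
`Bad K t` = histories with an event AT THE FINAL LEVEL `K` (age `0`).  Then `Σ_{T K} A = 1` and `Σ_{Bad K t} A = q K`
EXACTLY.  (a) IR-anchored: `q ≡ q₀ ∈ (0, 1]` constant ⇒ the class is saturated at level `q₀` and admits NO
`RelWeightBound` for ANY `W` and ANY second-run family.  (b) UV-anchored: `0 ≤ q j < 1`, `Σ q < ∞` ⇒ `RelWeightBound`
holds with `W = q`.  The single-run young class of exit (B1) is of kind (a) under the cell's reading of the printed
shapes (per-age factors, final coupling renormalised); kind (b) is what a LEVEL gain would look like. -/

namespace Sanity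

/-- toy histories: subsets of the levels `0, …, K`. [folklore] -/
def T (K : ℕ) : Finset (Finset ℕ) := (range (K + 1)).powerset

/-- product-Bernoulli weights with per-level event probabilities `q j`. [folklore] -/
def A (q : ℕ → ℝ) (K : ℕ) (_t : ℝ) (τ : Finset ℕ) : ℝ :=
  (∏ j ∈ τ, q j) * ∏ j ∈ range (K + 1) \ τ, (1 - q j)

/-- the YOUNG class: an event at the final level `K` — written as the image of the older part of the history.
[folklore] -/
def Bad (K : ℕ) (_t : ℝ) : Finset (Finset ℕ) := ((range K).powerset).image (insert K)

/-- membership: `τ ∈ Bad K t ↔ τ` is a history of cutoff `K` containing the final level. [folklore] -/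
theorem mem_Bad_iff {K : ℕ} {t : ℝ} {τ : Finset ℕ} : τ ∈ Bad K t ↔ τ ∈ T K ∧ K ∈ τ := by
  unfold Bad T
  constructor
  · rintro h
    obtain ⟨τ', hτ', rfl⟩ := mem_image.1 h
    refine ⟨mem_powerset.2 fun j hj => ?_, mem_insert_self K τ'⟩
    rcases mem_insert.1 hj with rfl | hj
    · exact self_mem_range_succ j
    · exact mem_range.2 ((mem_range.1 (mem_powerset.1 hτ' hj)).trans (Nat.lt_succ_self K))
  · rintro ⟨hT, hK⟩
    refine mem_image.2 ⟨τ.erase K, mem_powerset.2 fun j hj => ?_, insert_erase hK⟩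
    have hjK : j ≠ K := (mem_erase.1 hj).1
    have hjT := mem_range.1 (mem_powerset.1 hT (mem_erase.1 hj).2)
    exact mem_range.2 (lt_of_le_of_ne (Nat.lt_succ_iff.1 hjT) hjK)

/-- the young class consists of histories. [folklore] -/
theorem Bad_subset (K : ℕ) (t : ℝ) : Bad K t ⊆ T K := fun _ h => (mem_Bad_iff.1 h).1

/-- the toy weights are nonnegative for probabilities in `[0, 1]`. [folklore] -/
theorem A_nonneg {q : ℕ → ℝ} (hq0 : ∀ j, 0 ≤ q j) (hq1 : ∀ j, q j ≤ 1) (K : ℕ) (t : ℝ) (τ : Finset ℕ) :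
    0 ≤ A q K t τ :=
  mul_nonneg (prod_nonneg fun j _ => hq0 j) (prod_nonneg fun j _ => sub_nonneg.2 (hq1 j))

/-- the total weight is `∏_{j ≤ K} (q j + (1 − q j)) = 1`. [folklore] -/
theorem sum_T (q : ℕ → ℝ) (K : ℕ) (t : ℝ) : ∑ τ ∈ T K, A q K t τ = 1 := by
  unfold T A
  rw [← prod_add]
  simp

/-- the young class has weight EXACTLY `q K`. [folklore] -/
theorem sum_Bad (q : ℕ → ℝ) (K : ℕ) (t : ℝ) : ∑ τ ∈ Bad K t, A q K t τ = q K := by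
  unfold Bad
  have hnot : ∀ τ' ∈ (range K).powerset, K ∉ τ' := fun τ' hτ' hK => by
    have := mem_range.1 (mem_powerset.1 hτ' hK)
    exact lt_irrefl K this
  rw [sum_image (fun a ha b hb hab => by
    rw [← erase_insert (hnot a ha), hab, erase_insert (hnot b hb)])]
  have hterm : ∀ τ' ∈ (range K).powerset,
      A q K t (insert K τ') = q K * ((∏ j ∈ τ', q j) * ∏ j ∈ range K \ τ', (1 - q j)) := fun τ' hτ' => by
    unfold A
    have hsd : range (K + 1) \ insert K τ' = range K \ τ' := by
      ext j
      simp only [Finset.mem_sdiff, Finset.mem_range, Finset.mem_insert, not_or]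
      constructor
      · rintro ⟨h1, h2, h3⟩; exact ⟨by omega, h3⟩
      · rintro ⟨h1, h2⟩; exact ⟨by omega, by omega, h2⟩
    rw [prod_insert (hnot τ' hτ'), hsd]
    ring
  rw [sum_congr rfl hterm, ← mul_sum]
  have h1 : ∑ τ' ∈ (range K).powerset, (∏ j ∈ τ', q j) * ∏ j ∈ range K \ τ', (1 - q j) = 1 := by
    rw [← prod_add]; simp
  rw [h1, mul_one]

/-- EXACT RELATIVE WEIGHT: `Σ_{Bad} A = q K · Σ_{T} A` at every cutoff — with a constant `q` a `K`-UNIFORM relative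
weight, the shape of §3 (u). [folklore] -/
theorem sum_Bad_eq_mul_sum_T (q : ℕ → ℝ) (K : ℕ) (t : ℝ) :
    ∑ τ ∈ Bad K t, A q K t τ = q K * ∑ τ ∈ T K, A q K t τ := by
  rw [sum_Bad, sum_T, mul_one]

/-- (a) IR-ANCHORED: with a constant probability `q₀` the young class is SATURATED at level `q₀` (any `l₀ ≥ 0`; witness
`t = 0`). [folklore] -/
theorem saturated_const {l₀ q₀ : ℝ} (hl₀ : 0 ≤ l₀) : Saturated l₀ T (A fun _ => q₀) Bad q₀ := by
  refine Eventually.frequently (Eventually.of_forall fun K => ⟨0, by simpa using hl₀, ?_, ?_⟩)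
  · rw [sum_T]; exact one_pos
  · rw [sum_Bad_eq_mul_sum_T]

/-- (a) **THE YOUNG CLASS WITH CONSTANT PROBABILITY ADMITS NO `RelWeightBound` — for no `W`, whatever the second run.**
[folklore] -/
theorem not_relWeightBound_const {l₀ q₀ : ℝ} (hl₀ : 0 ≤ l₀) (hq₀ : 0 < q₀) (B : ℕ → ℝ → Finset ℕ → ℝ) (W : ℕ → ℝ) :
    ¬ RelWeightBound l₀ T (A fun _ => q₀) B Bad W :=
  not_relWeightBound_of_saturated hq₀ (saturated_const hl₀) W

/-- (b) UV-ANCHORED: with summable per-level probabilities `0 ≤ q j < 1` the SAME class is booked, `W = q` (both runs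
the toy family). [folklore] -/
theorem relWeightBound_of_summable {l₀ : ℝ} {q : ℕ → ℝ} (hq0 : ∀ j, 0 ≤ q j) (hq1 : ∀ j, q j < 1)
    (hs : Summable q) : RelWeightBound l₀ T (A q) (A q) Bad q where
  bad_subset K t _ := Bad_subset K t
  nonneg := hq0
  lt_one := hq1
  summable := hs
  bad_left K t _ := (sum_Bad_eq_mul_sum_T q K t).le
  bad_right K t _ := (sum_Bad_eq_mul_sum_T q K t).le

/-- the two outcomes side by side on the geometric example `q j = (1/2)^{j+1}` (summable, `< 1`) versus the constant
`q ≡ 1/2`. [folklore] -/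
example : RelWeightBound 1 T (A fun j => (1 / 2 : ℝ) ^ (j + 1)) (A fun j => (1 / 2 : ℝ) ^ (j + 1)) Bad
    (fun j => (1 / 2 : ℝ) ^ (j + 1)) :=
  relWeightBound_of_summable (fun j => by positivity)
    (fun j => pow_lt_one₀ (by norm_num) (by norm_num) (Nat.succ_ne_zero j))
    ((summable_geometric_two).comp_injective (add_left_injective 1))

example (W : ℕ → ℝ) : ¬ RelWeightBound 1 T (A fun _ => (1 / 2 : ℝ)) (A fun _ => (1 / 2 : ℝ)) Bad W :=
  not_relWeightBound_const zero_le_one one_half_pos _ W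

end Sanity

end Literature.MathematicalPhysics.QuantumFieldTheory.Balaban1983to89.T4BadClassBooking

end
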